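import Summits.Ventures.AbcSig.Rows.Statements
import Summits.Ventures.AbcSig.Rows.XnYn5Z2
import Summits.Ventures.AbcSig.Rows.XnYn7Z2Even
import Summits.Ventures.AbcSig.Rows.XnYn17Z2Even
import Summits.Ventures.AbcSig.Rows.X11Y11eq7Z2
import Summits.Ventures.AbcSig.Rows.X13Y13eq7Z2
import Summits.Ventures.AbcSig.Rows.X17Y17eq7Z2
import Summits.Ventures.AbcSig.Rows.X19Y19eq7Z2
import Summits.Ventures.AbcSig.Rows.XnYnZ2Even
import Summits.Ventures.AbcSig.Rows.XnYn3Z2Even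

/-!
# Venture AbcSig — BRIDGE: kernel-checked row theorems ⇒ census row statements (`Rows/Statements.lean`)

HONEST FRAMING. `pub-abcsig` is a COMPUTATION cell; nothing here bears on ABC or any summit. Each corollary below
re-states an already-landed CONDITIONAL row theorem (`Rows/….lean`) in the exact shape of the census statement
predicate written by p1 (`Summit.Ventures.AbcSig.Rows.C7Single`, `C1Cell`, `C1CellEven`), keeping every hypothesis
of the row visible: `BS04Package` (CITED: [BS04] Lemma 3.3 + Prop 4.3 packaged), `DataComplete N …` (COMPUTED:
the generated level files), `RefinedTraces …` (CITED+COMPUTED: Kraus fixed-exponent tables), `Excludes …` (CITED: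
[BS04] Prop 4.4 / 4.6 per orbit). No new mathematics; the proofs are instantiations.

C2a cells: the census predicate `C2aCellRed` quantifies over BOTH coefficient distributions `A·B = 2^a·ℓ^m`; the
general lemma `C2aCellRed_of_rows` below reduces it to the two row shapes (`Rows/C2aL<ℓ>A….lean`, distribution `A = 1`,
and `Rows/C2aL<ℓ>A…AB.lean`, distribution `(ℓ^m, 2^a)`, template `Rows/TemplateAB.lean`); the per-cell corollaries
live in `Rows/C2aL<ℓ>A…Cell.lean`.
-/

namespace Summit.Ventures.AbcSig

/-- C7, `n = 11`: the row `row_X11Y11eq7Z2` in the shape `Rows.C7Single 11`. -/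
theorem C7Single_11_of (M : NewformModel) (hP : M.BS04Package)
    (hD98 : M.DataComplete 98 level98k11Orbits) (hD1568 : M.DataComplete 1568 level1568k11Orbits)
    (hAv : M.RefinedTraces (fun S => S.A = 1 ∧ S.B = 1 ∧ S.C = 7 ∧ S.n = 11 ∧ 2 ∣ S.a * S.b) krausAllowed_C7_v_n11)
    (hAi : M.RefinedTraces (fun S => S.A = 1 ∧ S.B = 1 ∧ S.C = 7 ∧ S.n = 11 ∧ ¬ 2 ∣ S.a * S.b) krausAllowed_C7_i_n11)
    (hX4 : M.Excludes 1568 orbit_1568_4_k11 (fun S => S.A = 1 ∧ S.B = 1 ∧ S.C = 7 ∧ S.n = 11 ∧ ¬ 2 ∣ S.a * S.b))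
    (hX5 : M.Excludes 1568 orbit_1568_5_k11 (fun S => S.A = 1 ∧ S.B = 1 ∧ S.C = 7 ∧ S.n = 11 ∧ ¬ 2 ∣ S.a * S.b))
    (hX6 : M.Excludes 1568 orbit_1568_6_k11 (fun S => S.A = 1 ∧ S.B = 1 ∧ S.C = 7 ∧ S.n = 11 ∧ ¬ 2 ∣ S.a * S.b)) :
    Rows.C7Single 11 :=
  fun a b c => row_X11Y11eq7Z2 M hP hD98 hD1568 hAv hAi hX4 hX5 hX6 a b c

/-- C7, `n = 13`: the row `row_X13Y13eq7Z2` in the shape `Rows.C7Single 13`. -/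
theorem C7Single_13_of (M : NewformModel) (hP : M.BS04Package)
    (hD98 : M.DataComplete 98 level98k13Orbits) (hD1568 : M.DataComplete 1568 level1568k13Orbits)
    (hAv : M.RefinedTraces (fun S => S.A = 1 ∧ S.B = 1 ∧ S.C = 7 ∧ S.n = 13 ∧ 2 ∣ S.a * S.b) krausAllowed_C7_v_n13)
    (hAi : M.RefinedTraces (fun S => S.A = 1 ∧ S.B = 1 ∧ S.C = 7 ∧ S.n = 13 ∧ ¬ 2 ∣ S.a * S.b) krausAllowed_C7_i_n13)
    (hX4 : M.Excludes 1568 orbit_1568_4_k13 (fun S => S.A = 1 ∧ S.B = 1 ∧ S.C = 7 ∧ S.n = 13 ∧ ¬ 2 ∣ S.a * S.b))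
    (hX5 : M.Excludes 1568 orbit_1568_5_k13 (fun S => S.A = 1 ∧ S.B = 1 ∧ S.C = 7 ∧ S.n = 13 ∧ ¬ 2 ∣ S.a * S.b))
    (hX6 : M.Excludes 1568 orbit_1568_6_k13 (fun S => S.A = 1 ∧ S.B = 1 ∧ S.C = 7 ∧ S.n = 13 ∧ ¬ 2 ∣ S.a * S.b)) :
    Rows.C7Single 13 :=
  fun a b c => row_X13Y13eq7Z2 M hP hD98 hD1568 hAv hAi hX4 hX5 hX6 a b c

/-- C7, `n = 17`: the row `row_X17Y17eq7Z2` in the shape `Rows.C7Single 17`. -/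
theorem C7Single_17_of (M : NewformModel) (hP : M.BS04Package)
    (hD98 : M.DataComplete 98 level98k17Orbits) (hD1568 : M.DataComplete 1568 level1568k17Orbits)
    (hAv : M.RefinedTraces (fun S => S.A = 1 ∧ S.B = 1 ∧ S.C = 7 ∧ S.n = 17 ∧ 2 ∣ S.a * S.b) krausAllowed_C7_v_n17)
    (hAi : M.RefinedTraces (fun S => S.A = 1 ∧ S.B = 1 ∧ S.C = 7 ∧ S.n = 17 ∧ ¬ 2 ∣ S.a * S.b) krausAllowed_C7_i_n17)
    (hX4 : M.Excludes 1568 orbit_1568_4_k17 (fun S => S.A = 1 ∧ S.B = 1 ∧ S.C = 7 ∧ S.n = 17 ∧ ¬ 2 ∣ S.a * S.b))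
    (hX5 : M.Excludes 1568 orbit_1568_5_k17 (fun S => S.A = 1 ∧ S.B = 1 ∧ S.C = 7 ∧ S.n = 17 ∧ ¬ 2 ∣ S.a * S.b))
    (hX6 : M.Excludes 1568 orbit_1568_6_k17 (fun S => S.A = 1 ∧ S.B = 1 ∧ S.C = 7 ∧ S.n = 17 ∧ ¬ 2 ∣ S.a * S.b)) :
    Rows.C7Single 17 :=
  fun a b c => row_X17Y17eq7Z2 M hP hD98 hD1568 hAv hAi hX4 hX5 hX6 a b c

/-- C7, `n = 19`: the row `row_x19_add_y19_eq_7z2` in the shape `Rows.C7Single 19`. -/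
theorem C7Single_19_of (M : NewformModel) (hP : M.BS04Package)
    (hD98 : M.DataComplete 98 level98k19Orbits) (hD1568 : M.DataComplete 1568 level1568k19Orbits)
    (hAv : M.RefinedTraces (fun S => S.A = 1 ∧ S.B = 1 ∧ S.C = 7 ∧ S.n = 19 ∧ 2 ∣ S.a * S.b) krausAllowed_C7_v_n19)
    (hAi : M.RefinedTraces (fun S => S.A = 1 ∧ S.B = 1 ∧ S.C = 7 ∧ S.n = 19 ∧ ¬ 2 ∣ S.a * S.b) krausAllowed_C7_i_n19)
    (hX4 : M.Excludes 1568 orbit_1568_4_k19 (fun S => S.A = 1 ∧ S.B = 1 ∧ S.C = 7 ∧ S.n = 19 ∧ ¬ 2 ∣ S.a * S.b))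
    (hX5 : M.Excludes 1568 orbit_1568_5_k19 (fun S => S.A = 1 ∧ S.B = 1 ∧ S.C = 7 ∧ S.n = 19 ∧ ¬ 2 ∣ S.a * S.b))
    (hX6 : M.Excludes 1568 orbit_1568_6_k19 (fun S => S.A = 1 ∧ S.B = 1 ∧ S.C = 7 ∧ S.n = 19 ∧ ¬ 2 ∣ S.a * S.b)) :
    Rows.C7Single 19 :=
  fun a b c => row_x19_add_y19_eq_7z2 M hP hD98 hD1568 hAv hAi hX4 hX5 hX6 a b c

/-- C1, `C = 5`: the row `row_xn_add_yn_eq_5z2` (every prime `n ≥ 7`, both parities; five [BS04, Prop 4.4]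
exclusions at level 800, one per exponent) in the shape `Rows.C1Cell 5 7 ∅` (whose `|xy| > 1` side conditions are
not even needed). -/
theorem C1Cell_5_of (M : NewformModel) (hP : M.BS04Package)
    (hD50 : M.DataComplete 50 level50Orbits) (hD800 : M.DataComplete 800 level800Orbits)
    (hX1 : ∀ n : ℕ, M.Excludes 800 orbit_800_1 (fun S => S.A = 1 ∧ S.B = 1 ∧ S.C = 5 ∧ S.n = n ∧ ¬ 2 ∣ S.a * S.b))
    (hX4 : ∀ n : ℕ, M.Excludes 800 orbit_800_4 (fun S => S.A = 1 ∧ S.B = 1 ∧ S.C = 5 ∧ S.n = n ∧ ¬ 2 ∣ S.a * S.b))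
    (hX5 : ∀ n : ℕ, M.Excludes 800 orbit_800_5 (fun S => S.A = 1 ∧ S.B = 1 ∧ S.C = 5 ∧ S.n = n ∧ ¬ 2 ∣ S.a * S.b))
    (hX6 : ∀ n : ℕ, M.Excludes 800 orbit_800_6 (fun S => S.A = 1 ∧ S.B = 1 ∧ S.C = 5 ∧ S.n = n ∧ ¬ 2 ∣ S.a * S.b))
    (hX9 : ∀ n : ℕ, M.Excludes 800 orbit_800_9 (fun S => S.A = 1 ∧ S.B = 1 ∧ S.C = 5 ∧ S.n = n ∧ ¬ 2 ∣ S.a * S.b)) :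
    Rows.C1Cell 5 7 ∅ :=
  fun n hn h7 _ _ x y z _ _ => row_xn_add_yn_eq_5z2 M hP hD50 hD800 n hn h7 (hX1 n) (hX4 n) (hX5 n) (hX6 n) (hX9 n) x y z

/-- C1, `C = 7`, `xy` even: the row `row_XnYn7Z2Even` (every prime `n ≥ 11`; the [BS04, Prop 4.4] exclusion of
orbit 98.1 per exponent) in the shape `Rows.C1CellEven 7 11 ∅`. -/
theorem C1CellEven_7_of (M : NewformModel) (hP : M.BS04Package) (hD98 : M.DataComplete 98 level98Orbits)
    (hX : ∀ n : ℕ, M.Excludes 98 orbit_98_1 (fun S => S.A = 1 ∧ S.B = 1 ∧ S.C = 7 ∧ S.n = n ∧ 2 ∣ S.a * S.b)) :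
    Rows.C1CellEven 7 11 ∅ :=
  fun n hn h11 _ _ x y z hpar => row_XnYn7Z2Even M hP hD98 n hn h11 (hX n) x y z hpar

/-- C1, `C = 17`, `xy` even (STEP-0, [BS04] §5 level 578): the row `row_xn_add_yn_eq_17z2_even` (prime `n ≥ 7`,
`n ∉ {7, 17}`; the [BS04, Prop 4.4] exclusion of orbit 578.1 per exponent) in the shape `Rows.C1CellEven 17 7 {7}`
(`n ≠ 17` is the predicate's `¬ n ∣ C`). -/
theorem C1CellEven_17_of (M : NewformModel) (hP : M.BS04Package) (hD : M.DataComplete 578 level578Orbits)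
    (hX : ∀ n : ℕ, M.Excludes 578 orbit_578_1 (fun S => S.A = 1 ∧ S.B = 1 ∧ S.C = 17 ∧ S.n = n ∧ 2 ∣ S.a * S.b)) :
    Rows.C1CellEven 17 7 {7} :=
  fun n hn h7 h17 hR x y z hpar =>
    row_xn_add_yn_eq_17z2_even M hP hD n hn h7
      (by
        have h7' : n ≠ 7 := by simpa using hR
        have h17' : n ≠ 17 := fun h => h17 (h ▸ dvd_refl _)
        simp only [List.mem_cons, List.not_mem_nil, or_false, not_or]; exact ⟨h7', h17'⟩)
      (hX n) x y z hpar

/-- C1, `C = 1`, `xy` even ([BS04, Thm 1.1]; level 2 carries NO newform, `level2Orbits = []`): the row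
`row_XnYnZ2Even` in the shape `Rows.C1CellEven 1 7 ∅`. -/
theorem C1CellEven_1_of (M : NewformModel) (hP : M.BS04Package) (hD2 : M.DataComplete 2 level2Orbits) :
    Rows.C1CellEven 1 7 ∅ :=
  fun n hn h7 _ _ x y z hpar => row_XnYnZ2Even M hP hD2 n hn h7 x y z hpar

/-- C1, `C = 3`, `xy` even ([BS04, Thm 1.1]; level 18 carries NO newform, `level18Orbits = []`): the row
`row_XnYn3Z2Even` in the shape `Rows.C1CellEven 3 7 ∅`. -/
theorem C1CellEven_3_of (M : NewformModel) (hP : M.BS04Package) (hD18 : M.DataComplete 18 level18Orbits) :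
    Rows.C1CellEven 3 7 ∅ :=
  fun n hn h7 _ _ x y z hpar => row_XnYn3Z2Even M hP hD18 n hn h7 x y z hpar

/-- Coprime factorisations of `2^a · ℓ^m` (`ℓ` an odd prime): the four coefficient distributions. -/
theorem coprime_distributions {ℓ a m A B : ℕ} (hℓ : ℓ.Prime) (hℓ2 : ℓ ≠ 2) (hAB : Nat.Coprime A B)
    (hprod : A * B = 2 ^ a * ℓ ^ m) :
    (A = 1 ∧ B = 2 ^ a * ℓ ^ m) ∨ (A = 2 ^ a * ℓ ^ m ∧ B = 1) ∨ (A = 2 ^ a ∧ B = ℓ ^ m) ∨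
      (A = ℓ ^ m ∧ B = 2 ^ a) := by
  have hP0 : 0 < 2 ^ a * ℓ ^ m := by have := hℓ.pos; positivity
  -- a prime power dividing a product of coprime numbers divides one of them
  have key : ∀ (p k : ℕ), p.Prime → p ^ k ∣ A * B → p ^ k ∣ A ∨ p ^ k ∣ B := by
    intro p k hp hdiv
    rcases Nat.eq_zero_or_pos k with rfl | hk
    · left; simp
    have hpAB : p ∣ A * B := (dvd_pow_self p hk.ne').trans hdiv
    rcases hp.dvd_mul.mp hpAB with hpA | hpB
    · left
      have hcop : Nat.Coprime (p ^ k) B := Nat.Coprime.pow_left k (Nat.Coprime.coprime_dvd_left hpA hAB)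
      exact hcop.dvd_of_dvd_mul_right hdiv
    · right
      have hcop : Nat.Coprime (p ^ k) A := Nat.Coprime.pow_left k (Nat.Coprime.coprime_dvd_left hpB hAB.symm)
      exact hcop.dvd_of_dvd_mul_left hdiv
  have h2 : 2 ^ a ∣ A ∨ 2 ^ a ∣ B := key 2 a Nat.prime_two (hprod ▸ dvd_mul_right _ _)
  have hl : ℓ ^ m ∣ A ∨ ℓ ^ m ∣ B := key ℓ m hℓ (hprod ▸ dvd_mul_left _ _)
  have hcop2l : Nat.Coprime (2 ^ a) (ℓ ^ m) :=
    Nat.Coprime.pow _ _ ((Nat.coprime_primes Nat.prime_two hℓ).mpr (Ne.symm hℓ2))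
  -- `u * v = 1` in `ℕ`
  have one : ∀ u v : ℕ, 2 ^ a * ℓ ^ m * (u * v) = A * B → u = 1 ∧ v = 1 := by
    intro u v h
    have h1 : u * v = 1 := by
      have h' : 2 ^ a * ℓ ^ m * (u * v) = 2 ^ a * ℓ ^ m * 1 := by rw [mul_one, h, hprod]
      exact Nat.eq_of_mul_eq_mul_left hP0 h'
    exact ⟨Nat.eq_one_of_mul_eq_one_right h1, Nat.eq_one_of_mul_eq_one_left h1⟩
  rcases h2 with ⟨k, hk⟩ | ⟨k, hk⟩ <;> rcases hl with hl | hl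
  · -- 2^a | A, ℓ^m | A
    obtain ⟨j, hj⟩ := hcop2l.mul_dvd_of_dvd_of_dvd ⟨k, hk⟩ hl
    have h := one j B (by rw [hj]; ring)
    obtain ⟨rfl, rfl⟩ := h
    right; left; exact ⟨by rw [hj, mul_one], rfl⟩
  · -- 2^a | A, ℓ^m | B
    obtain ⟨j, hj⟩ := hl
    have h := one k j (by rw [hk, hj]; ring)
    obtain ⟨rfl, rfl⟩ := h
    right; right; left; exact ⟨by rw [hk, mul_one], by rw [hj, mul_one]⟩
  · -- 2^a | B, ℓ^m | A
    obtain ⟨j, hj⟩ := hl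
    have h := one k j (by rw [hk, hj]; ring)
    obtain ⟨rfl, rfl⟩ := h
    right; right; right; exact ⟨by rw [hj, mul_one], by rw [hk, mul_one]⟩
  · -- 2^a | B, ℓ^m | B
    obtain ⟨j, hj⟩ := hcop2l.mul_dvd_of_dvd_of_dvd ⟨k, hk⟩ hl
    have h := one A j (by rw [hj]; ring)
    obtain ⟨rfl, rfl⟩ := h
    left; exact ⟨rfl, by rw [hj, mul_one]⟩

/-- **C2a cells from the two coefficient distributions.** If both `xⁿ + 2^a ℓ^m yⁿ = z²` (distribution `A = 1`,
rows `row_C2aL<ℓ>A…`) and `ℓ^m xⁿ + 2^a yⁿ = z²` (rows `row_C2aL<ℓ>A…AB`) have no admissible solution, then the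
census cell statement `Rows.C2aCellRed ℓ aok R` (all coprime `A·B = 2^a·ℓ^m`, RULING H1 reduced exponents) holds:
the other two distributions are swaps (`IsPrimitiveSolution.swap`). Pure logic + `coprime_distributions`. -/
theorem C2aCellRed_of_rows (ℓ : ℕ) (hℓ : ℓ.Prime) (hℓ2 : ℓ ≠ 2) (aok : ℕ → Prop) (R : Finset ℕ)
    (h1 : ∀ n : ℕ, n.Prime → 11 ≤ n → n ≠ ℓ → n ∉ R → ∀ a m : ℕ, aok a → a < n → 1 ≤ m → m < n →
      ∀ x y z : ℤ, x * y ≠ 1 → x * y ≠ -1 → ¬ IsPrimitiveSolution 1 (2 ^ a * ℓ ^ m) 1 n x y z)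
    (h2 : ∀ n : ℕ, n.Prime → 11 ≤ n → n ≠ ℓ → n ∉ R → ∀ a m : ℕ, aok a → a < n → 1 ≤ m → m < n →
      ∀ x y z : ℤ, x * y ≠ 1 → x * y ≠ -1 → ¬ IsPrimitiveSolution (ℓ ^ m) (2 ^ a) 1 n x y z) :
    Rows.C2aCellRed ℓ aok R := by
  intro n hn h11 hnℓ hR A B a m ha han hm hmn hAB hprod x y z hxy1 hxy2 hsol
  have hyx1 : y * x ≠ 1 := by rwa [mul_comm]
  have hyx2 : y * x ≠ -1 := by rwa [mul_comm]
  rcases coprime_distributions hℓ hℓ2 hAB hprod with ⟨rfl, rfl⟩ | ⟨rfl, rfl⟩ | ⟨rfl, rfl⟩ | ⟨rfl, rfl⟩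
  · exact h1 n hn h11 hnℓ hR a m ha han hm hmn x y z hxy1 hxy2 hsol
  · exact h1 n hn h11 hnℓ hR a m ha han hm hmn y x z hyx1 hyx2 hsol.swap
  · exact h2 n hn h11 hnℓ hR a m ha han hm hmn y x z hyx1 hyx2 hsol.swap
  · exact h2 n hn h11 hnℓ hR a m ha han hm hmn x y z hxy1 hxy2 hsol

end Summit.Ventures.AbcSig
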